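/-
Copyright (c) 2026 the pub-hodgecm-mathlib formalisation cell (harness21).  Prover seat hodgecm-mathlib-F0P3a-p04 (g32): E1 row 47d (M2) «THE LOCAL MODELS OF THE VERTEX AND EDGE
BLOCKS OF THE SCHNEIDER–STUHLER COMPLEX, THEIR STABILISERS, AND THE `N ≤ P` DICTIONARY» (the (L1)∕(L2) link letters `emb j`, `Nr j`, `φN j`, `tr′`, `hperm′` of ★ row 60
`finrank_intertwiningMap_smoothIndRep_eq_sum_finrank_block_eigen` at the tree; dealt by the E1 keeper F0P3a-p03 (g30) 03:55:57Z), over ★ FILE 5a (this lineage, g31), 2026-09-03.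
-/
import Literature.NumberTheory.Automorphic.SchneiderStuhlerTreeComplexGlobal   -- ★ 5a: `rep_zeroChains_single`, `rep_oneChains_single`, the blocks `[x ↦ V^{U_x}]`, `[e ↦ V^{U_e}]`
import Literature.NumberTheory.Automorphic.JacquetModule                      -- `ParabolicTriple`, `ParabolicTriple.restrict`
import HarnessLib

/-!
# The local models of the vertex and edge blocks of the Schneider–Stuhler complex, their stabilisers, and the `N ≤ P` dictionary

Topic `NumberTheory/Automorphic`; namespace `Representation`; THEOREMS ONLY (no definition, instance, notation or named fact); imports ★ FILE 5a, ★ `JacquetModule`, HarnessLib.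
Cell `pub/hodgecm-mathlib` (D-0151), crux H413 = `stmt-HodgeConjecture-24833`, lane `--supports`; E1 row 47d, brick (M2) of CENSUS-R61 §3 (F0P2-p06 (g22)).  Count-neutral generic
base layer; HC_CM is proved only modulo the 7 printed citations (2 remaining named inputs: hLiu418 = `stmt-HodgeConjecture-24832`, h413 = `stmt-HodgeConjecture-24833`) until rung 0
closes.

THE LINK LETTERS.  ★ row 60 `finrank_intertwiningMap_smoothIndRep_eq_sum_finrank_block_eigen` (the per-type wrapper `hm_q` of ★ 47d HEAD v2) asks, besides the Mackey data of ★ (α), for the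
block-permutation data of ★ (G4) over the unipotent radical in `N ≤ P` currency (`τM = t.restrict ρ_q`, `act`, `hact hact1 hperm`, `tr htr hrep_act`), and for every Mackey
representative `j` a LOCAL MODEL `emb j : E′_j ↪ M` of the block of the facet `r j` (`hinj hrange`), the STABILISER `Nr j` of `r j` (`hNr`), an inclusion `φN j : Nr j →* T j`, and the
equivariance letters `hembN` (unipotent stabiliser) and `hembT` (compact torus).  At the global Schneider–Stuhler complex of ★ FILE 5a (`M = C₀(S)` resp. `C₁(S)` with the blocks
`[x ↦ V^{U_x}]`, `[e ↦ V^{U_e}]` permuted along the `Γ`-action on the tree) this file supplies all of them, hypothesis-free, as ∃-PACKAGES indexed by an arbitrary representative type `κ`: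
* §1 `exists_stabilizer_subgroups`: the stabilisers of a family `r : κ → β` under an action `act : N → β → β` given as a function (`hact hact1`), as subgroups with `s ∈ Nr j ↔ act s (r j) = r j`;
  `exists_monoidHoms_of_coe_mem`: subgroups `Nr j ≤ A ≤ P ≤ Γ` whose elements lie in `T j ≤ Γ` map into `T j` over `Γ` (the letter `φN j`; at the datum `A = N ∩ P`, `T j = B ∩ P_{r j}`);
  `ParabolicTriple.restrict_apply`; `exists_restrict_blockData`: THE `N ≤ P` DICTIONARY — block-permutation data given over `G` with `tr b ∈ N`, `rep (n·b) = rep b (n ∈ N)` yields the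
  data of ★ 47c FILE 1 ∕ ★ (G4) over `↥(N.subgroupOf P)` for `t.restrict ρ` (the three `have`s of ★ 47c FILE 3, exported once).
* §2 **`exists_localModels_zeroBlocks`**: for vertices `y : κ → ι` in `S`, injective linear maps `emb j : V^{U_{y j}} → C₀(S)`, `e ↦ [y j ↦ e]`, with `range (emb j)` = the vertex block of
  `y j`, and the EQUIVARIANCE LETTER: `g·(y j) = y j`, `e′ = ρ(g) e` ⟹ `emb j e′ = ρ₀(g) (emb j e)` (so ★ row 60's `hembN`∕`hembT` are one `hτ′` away, for `g` in the unipotent stabiliser resp.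
  the compact torus fixing `y j`).
* §3 **`exists_localModels_oneBlocks`**: the same for edges `b : κ → G.edgeSet` and the edge blocks `[b j ↦ V^{U_{head} ⊔ U_{tail}}]` of `C₁(S)` (invariance `(a g)·(b j) = b j`).

## References
* [SchneiderStuhler1997] P. Schneider, U. Stuhler, *Representation theory and sheaves on the Bruhat–Tits building*, Publ. Math. IHÉS 85 (1997), Ch. II §3, Ch. III §4 (Lemma III.4.13).
* [Brown1982] K. S. Brown, *Cohomology of Groups*, GTM 87 (1982), III §5–§6 ((5.4), (6.2): the summands of an induced∕permutation module and their stabilisers).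
* [Casselman1995] W. Casselman, *Introduction to the theory of admissible representations of `p`-adic reductive groups* (1995 notes), §3.1, §6.3.
-/

set_option autoImplicit false

open scoped BigOperators Pointwise
open SimpleGraph Finset
open Literature.NumberTheory.Automorphic Literature.Combinatorics.SimpleGraph Literature.Combinatorics.SimpleGraph.OrientedIncidence

/-! ## §1 Stabilisers of an action given as a function; inclusion homomorphisms over `Γ`; the `N ≤ P` dictionary -/

namespace Representation

section Stabilizer

variable {N β : Type*} [Group N] (act : N → β → β)

/-- **THE STABILISERS OF A FAMILY OF POINTS** under an action `act : N → β → β` given as a function (`hact`, `hact1`): subgroups `Nr j ≤ N` with `s ∈ Nr j ↔ act s (r j) = r j` — the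
letter `hNr` of ★ (G4) ∕ ★ row 60. [cite: Brown1982, III §5 (5.4)] -/
theorem exists_stabilizer_subgroups (hact : ∀ n n' b, act (n * n') b = act n (act n' b)) (hact1 : ∀ b, act 1 b = b) {κ : Type*} (r : κ → β) :
    ∃ Nr : κ → Subgroup N, ∀ (j : κ) (s : N), s ∈ Nr j ↔ act s (r j) = r j := by
  refine ⟨fun j => { carrier := {s | act s (r j) = r j}, mul_mem' := ?_, one_mem' := hact1 (r j), inv_mem' := ?_ }, fun j s => Iff.rfl⟩
  · intro s s' hs hs'
    simp only [Set.mem_setOf_eq] at hs hs' ⊢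
    rw [hact, hs', hs]
  · intro s hs
    simp only [Set.mem_setOf_eq] at hs ⊢
    calc act s⁻¹ (r j) = act s⁻¹ (act s (r j)) := by rw [hs]
      _ = r j := by rw [← hact, inv_mul_cancel, hact1]

end Stabilizer

section Inclusion

variable {Γ : Type*} [Group Γ] {P : Subgroup Γ} {A : Subgroup P}

/-- **INCLUSION HOMOMORPHISMS OVER `Γ`**: subgroups `Nr j` of `↥A` (`A ≤ P ≤ Γ`, e.g. `A = N ∩ P`) whose elements lie in `T j ≤ Γ` map into `T j` by group homomorphisms commuting with the
coercions to `Γ` — the letter `φN j : Nr j →* T j` of ★ row 60. [cite: Brown1982, III §5 (5.4)] -/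
theorem exists_monoidHoms_of_coe_mem {κ : Type*} (Nr : κ → Subgroup A) (T : κ → Subgroup Γ) (h : ∀ j, ∀ s ∈ Nr j, (((s : A) : P) : Γ) ∈ T j) :
    ∃ φ : ∀ j, ↥(Nr j) →* ↥(T j), ∀ (j : κ) (s : Nr j), ((φ j s : T j) : Γ) = ((((s : Nr j) : A) : P) : Γ) := by
  refine ⟨fun j => { toFun := fun s => ⟨((((s : Nr j) : A) : P) : Γ), h j (s : A) s.2⟩, map_one' := Subtype.ext ?_, map_mul' := fun s s' => Subtype.ext ?_ }, fun j s => rfl⟩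
  · simp only [OneMemClass.coe_one]
  · simp only [Subgroup.coe_mul]

end Inclusion

end Representation

namespace Literature.NumberTheory.Automorphic.ParabolicTriple

/-- `t.restrict ρ s = ρ s` (`s ∈ N ∩ P` read in `G`). [cite: Casselman1995, §3.1] -/
theorem restrict_apply {G : Type*} [Group G] (t : ParabolicTriple G) {k V : Type*} [CommRing k] [AddCommGroup V] [Module k V] (ρ : Representation k G V)
    (s : ↥(t.N.subgroupOf t.P)) : t.restrict ρ s = ρ ((s : t.P) : G) :=
  rfl

end Literature.NumberTheory.Automorphic.ParabolicTriple

namespace Representation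

section Dictionary

variable {k G M : Type*} [CommRing k] [Group G] [AddCommGroup M] [Module k M] (t : ParabolicTriple G) (ρ : Representation k G M)
  {β : Type*} (Blk : β → Submodule k M) (act : G → β → β)

/-- **THE `N ≤ P` DICTIONARY**: block-permutation data given over `G` (`hact hact1 hperm`, orbit data `rep tr` with `tr b ∈ N` and `rep` constant on `N`-orbits) yields the data of ★ 47c
FILE 1 ∕ ★ (G4) ∕ ★ row 60 over `Nty = ↥(N.subgroupOf P)` for `τM = t.restrict ρ` and `act′ s b = act ↑s b`: a transporter `tr′` lifting `tr`, and the letters `hact′ hact1′ hperm′ htr′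
hrep_act′` (the three `have`s of ★ 47c FILE 3 `isInternal_heightPiece_jacquet_and_shift`, exported). [cite: Casselman1995, §6.3] -/
theorem exists_restrict_blockData (hact : ∀ g g' b, act (g * g') b = act g (act g' b)) (hact1 : ∀ b, act 1 b = b)
    (hperm : ∀ g b m, m ∈ Blk b → ρ g m ∈ Blk (act g b))
    (rep : β → β) (tr : β → G) (htrN : ∀ b, tr b ∈ t.N) (htr : ∀ b, act (tr b) (rep b) = b) (hrep_act : ∀ n ∈ t.N, ∀ b, rep (act n b) = rep b) :
    ∃ tr' : β → ↥(t.N.subgroupOf t.P),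
      (∀ b, (((tr' b : ↥(t.N.subgroupOf t.P)) : t.P) : G) = tr b) ∧
      (∀ (n n' : ↥(t.N.subgroupOf t.P)) (b : β), act (((n * n' : ↥(t.N.subgroupOf t.P)) : t.P) : G) b = act ((n : t.P) : G) (act ((n' : t.P) : G) b)) ∧
      (∀ b : β, act (((1 : ↥(t.N.subgroupOf t.P)) : t.P) : G) b = b) ∧
      (∀ (n : ↥(t.N.subgroupOf t.P)) (b : β) (m : M), m ∈ Blk b → t.restrict ρ n m ∈ Blk (act ((n : t.P) : G) b)) ∧
      (∀ b, act (((tr' b : ↥(t.N.subgroupOf t.P)) : t.P) : G) (rep b) = b) ∧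
      (∀ (n : ↥(t.N.subgroupOf t.P)) (b : β), rep (act ((n : t.P) : G) b) = rep b) :=
  ⟨fun b => ⟨⟨tr b, t.N_le (htrN b)⟩, Subgroup.mem_subgroupOf.2 (htrN b)⟩, fun _ => rfl, fun n n' b => hact ((n : t.P) : G) ((n' : t.P) : G) b, fun b => hact1 b,
    fun n b m hm => hperm ((n : t.P) : G) b m hm, fun b => htr b, fun n b => hrep_act _ (Subgroup.mem_subgroupOf.1 n.2) b⟩

end Dictionary

/-! ## §2 The local models of the vertex blocks -/

section Chains

variable {k Γ V : Type*} [Field k] [Group Γ] [AddCommGroup V] [Module k V] {ρ : Representation k Γ V}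
variable {ι : Type*} {G : SimpleGraph ι} {a : Γ →* (G ≃g G)}
variable {τ : Representation k Γ (ι →₀ V)} (hτ : ∀ (g : Γ) (v : ι →₀ V), τ g v = Finsupp.mapRange (ρ g) (map_zero _) (Finsupp.equivMapDomain (a g).toEquiv v))
variable {τ₁ : Representation k Γ (G.edgeSet →₀ V)}
  (hτ₁ : ∀ (g : Γ) (c : G.edgeSet →₀ V), τ₁ g c = Finsupp.mapRange (ρ g) (map_zero _) (Finsupp.equivMapDomain (a g).mapEdgeSet c))

/-- **`ρ(g) V^{U_x} = V^{U_{g·x}}`** for transported vertex groups (★ row 23 `map_fixedPoints_eq_fixedPoints_map_conj` + `hUa`) — the letter `hE : E.map (ρ (g j)) = E′ j` of ★ (α) ∕ ★ row 60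
with `E′ j = V^{U_{g_j·x}}`. [cite: SchneiderStuhler1997, Ch. III §4] -/
theorem map_fixedPoints_eq_fixedPoints_act {U : ι → Subgroup Γ} (hUa : ∀ (g : Γ) (x : ι), U (a g x) = (U x).map (MulAut.conj g).toMonoidHom) (g : Γ) (x : ι) :
    (ρ.fixedPoints (U x)).map (ρ g) = ρ.fixedPoints (U (a g x)) := by
  rw [hUa, map_fixedPoints_eq_fixedPoints_map_conj]

/-- **`ρ(g) V^{U_x ⊔ U_y} = V^{U_{g·x} ⊔ U_{g·y}}`** (edge groups) — the letter `hE` for the edge type. [cite: SchneiderStuhler1997, Ch. III §4] -/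
theorem map_fixedPoints_sup_eq_fixedPoints_act {U : ι → Subgroup Γ} (hUa : ∀ (g : Γ) (x : ι), U (a g x) = (U x).map (MulAut.conj g).toMonoidHom) (g : Γ) (x y : ι) :
    (ρ.fixedPoints (U x ⊔ U y)).map (ρ g) = ρ.fixedPoints (U (a g x) ⊔ U (a g y)) := by
  rw [hUa, hUa, ← Subgroup.map_sup, map_fixedPoints_eq_fixedPoints_map_conj]

include hτ in
/-- **THE LOCAL MODELS OF THE VERTEX BLOCKS**: for vertices `y : κ → ι` of `S`, the maps `emb j : V^{U_{y j}} → C₀(S)`, `e ↦ [y j ↦ e]`, are injective linear maps with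
`range (emb j)` = the vertex block `[y j ↦ V^{U_{y j}}]` of `C₀(S)` (the letters `emb hinj hrange` of ★ (G4) ∕ ★ row 60), `(emb j e : ι →₀ V) = single (y j) e`, and — THE EQUIVARIANCE
LETTER behind `hembN`∕`hembT` — for `g ∈ Γ` fixing `y j` and `e′ = ρ(g) e` in `V^{U_{y j}}`: `emb j e′ = ρ₀(g) (emb j e)`. [cite: SchneiderStuhler1997, Ch. II §3, Ch. III §4 Lemma III.4.13]
[cite: Brown1982, III §5 (5.4), §6 (6.2)] -/
theorem exists_localModels_zeroBlocks (U : ι → Subgroup Γ) (S : Set ι)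
    {ρ₀ : Representation k Γ ↥(⨆ x ∈ S, (ρ.fixedPoints (U x)).map (Finsupp.lsingle x : V →ₗ[k] ι →₀ V))} (hρ₀ : ∀ (g : Γ) v, ((ρ₀ g v : _) : ι →₀ V) = τ g v)
    {κ : Type*} (y : κ → ι) (hy : ∀ j, y j ∈ S) :
    ∃ emb : ∀ j, ↥(ρ.fixedPoints (U (y j))) →ₗ[k] ↥(⨆ x ∈ S, (ρ.fixedPoints (U x)).map (Finsupp.lsingle x : V →ₗ[k] ι →₀ V)),
      (∀ j, Function.Injective (emb j)) ∧
      (∀ j, LinearMap.range (emb j) = ((ρ.fixedPoints (U (y j))).map (Finsupp.lsingle (y j) : V →ₗ[k] ι →₀ V)).comap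
        (⨆ x ∈ S, (ρ.fixedPoints (U x)).map (Finsupp.lsingle x : V →ₗ[k] ι →₀ V)).subtype) ∧
      (∀ (j : κ) (e : ρ.fixedPoints (U (y j))), ((emb j e : _) : ι →₀ V) = Finsupp.single (y j) (e : V)) ∧
      (∀ (j : κ) (g : Γ), a g (y j) = y j → ∀ (e e' : ρ.fixedPoints (U (y j))), (e' : V) = ρ g e → emb j e' = ρ₀ g (emb j e)) := by
  -- membership of `[y j ↦ e]` in `C₀(S)`
  have hmem : ∀ (j : κ) (e : ρ.fixedPoints (U (y j))),
      (Finsupp.lsingle (y j) : V →ₗ[k] ι →₀ V) (e : V) ∈ ⨆ x ∈ S, (ρ.fixedPoints (U x)).map (Finsupp.lsingle x : V →ₗ[k] ι →₀ V) := fun j e =>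
    (le_biSup (fun x => (ρ.fixedPoints (U x)).map (Finsupp.lsingle x : V →ₗ[k] ι →₀ V)) (hy j)) (Submodule.mem_map_of_mem e.2)
  refine ⟨fun j => LinearMap.codRestrict _ ((Finsupp.lsingle (y j) : V →ₗ[k] ι →₀ V) ∘ₗ (ρ.fixedPoints (U (y j))).subtype) fun e => hmem j e,
    fun j => ?_, fun j => ?_, fun j e => rfl, fun j g hg e e' he' => ?_⟩
  · -- injective
    intro e e' h
    have h' := congrArg Subtype.val h
    simp only [LinearMap.codRestrict_apply, LinearMap.coe_comp, Function.comp_apply, Submodule.subtype_apply, Finsupp.lsingle_apply] at h'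
    exact Subtype.ext (Finsupp.single_injective (y j) h')
  · -- range = the vertex block
    ext m
    simp only [LinearMap.mem_range, Submodule.mem_comap, Submodule.subtype_apply, Submodule.mem_map]
    constructor
    · rintro ⟨e, rfl⟩
      exact ⟨(e : V), e.2, rfl⟩
    · rintro ⟨v, hv, hvm⟩
      exact ⟨⟨v, hv⟩, Subtype.ext hvm⟩
  · -- equivariance
    apply Subtype.ext
    rw [hρ₀]
    simp only [LinearMap.codRestrict_apply, LinearMap.coe_comp, Function.comp_apply, Submodule.subtype_apply, Finsupp.lsingle_apply]
    rw [rep_zeroChains_single hτ, hg, he']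

/-! ## §3 The local models of the edge blocks -/

include hτ₁ in
/-- **THE LOCAL MODELS OF THE EDGE BLOCKS**: for edges `b : κ → G.edgeSet` of `S` (both ends in `S`), the maps `emb j : V^{U_{head (b j)} ⊔ U_{tail (b j)}} → C₁(S)`, `e ↦ [b j ↦ e]`, are
injective linear maps with `range (emb j)` = the edge block of `b j`, `(emb j e : G.edgeSet →₀ V) = single (b j) e`, and for `g ∈ Γ` fixing the edge `b j` and `e′ = ρ(g) e`:
`emb j e′ = ρ₁(g) (emb j e)`. [cite: SchneiderStuhler1997, Ch. II §3, Ch. III §4 Lemma III.4.13] [cite: Brown1982, III §5 (5.4), §6 (6.2)] -/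
theorem exists_localModels_oneBlocks (σ : Orientation G) (U : ι → Subgroup Γ) (S : Set ι)
    {ρ₁ : Representation k Γ ↥(⨆ e ∈ {e : G.edgeSet | σ.head e ∈ S ∧ σ.tail e ∈ S}, (ρ.fixedPoints (U (σ.head e) ⊔ U (σ.tail e))).map (Finsupp.lsingle e : V →ₗ[k] G.edgeSet →₀ V))}
    (hρ₁ : ∀ (g : Γ) c, ((ρ₁ g c : _) : G.edgeSet →₀ V) = τ₁ g c)
    {κ : Type*} (b : κ → G.edgeSet) (hb : ∀ j, σ.head (b j) ∈ S ∧ σ.tail (b j) ∈ S) :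
    ∃ emb : ∀ j, ↥(ρ.fixedPoints (U (σ.head (b j)) ⊔ U (σ.tail (b j)))) →ₗ[k]
        ↥(⨆ e ∈ {e : G.edgeSet | σ.head e ∈ S ∧ σ.tail e ∈ S}, (ρ.fixedPoints (U (σ.head e) ⊔ U (σ.tail e))).map (Finsupp.lsingle e : V →ₗ[k] G.edgeSet →₀ V)),
      (∀ j, Function.Injective (emb j)) ∧
      (∀ j, LinearMap.range (emb j) = ((ρ.fixedPoints (U (σ.head (b j)) ⊔ U (σ.tail (b j)))).map (Finsupp.lsingle (b j) : V →ₗ[k] G.edgeSet →₀ V)).comap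
        (⨆ e ∈ {e : G.edgeSet | σ.head e ∈ S ∧ σ.tail e ∈ S}, (ρ.fixedPoints (U (σ.head e) ⊔ U (σ.tail e))).map (Finsupp.lsingle e : V →ₗ[k] G.edgeSet →₀ V)).subtype) ∧
      (∀ (j : κ) (e : ρ.fixedPoints (U (σ.head (b j)) ⊔ U (σ.tail (b j)))), ((emb j e : _) : G.edgeSet →₀ V) = Finsupp.single (b j) (e : V)) ∧
      (∀ (j : κ) (g : Γ), (a g).mapEdgeSet (b j) = b j → ∀ (e e' : ρ.fixedPoints (U (σ.head (b j)) ⊔ U (σ.tail (b j)))), (e' : V) = ρ g e →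
        emb j e' = ρ₁ g (emb j e)) := by
  have hmem : ∀ (j : κ) (e : ρ.fixedPoints (U (σ.head (b j)) ⊔ U (σ.tail (b j)))),
      (Finsupp.lsingle (b j) : V →ₗ[k] G.edgeSet →₀ V) (e : V) ∈
        ⨆ e ∈ {e : G.edgeSet | σ.head e ∈ S ∧ σ.tail e ∈ S}, (ρ.fixedPoints (U (σ.head e) ⊔ U (σ.tail e))).map (Finsupp.lsingle e : V →ₗ[k] G.edgeSet →₀ V) := fun j e =>
    (le_biSup (fun e : G.edgeSet => (ρ.fixedPoints (U (σ.head e) ⊔ U (σ.tail e))).map (Finsupp.lsingle e : V →ₗ[k] G.edgeSet →₀ V)) (hb j)) (Submodule.mem_map_of_mem e.2)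
  refine ⟨fun j => LinearMap.codRestrict _ ((Finsupp.lsingle (b j) : V →ₗ[k] G.edgeSet →₀ V) ∘ₗ (ρ.fixedPoints (U (σ.head (b j)) ⊔ U (σ.tail (b j)))).subtype) fun e => hmem j e,
    fun j => ?_, fun j => ?_, fun j e => rfl, fun j g hg e e' he' => ?_⟩
  · intro e e' h
    have h' := congrArg Subtype.val h
    simp only [LinearMap.codRestrict_apply, LinearMap.coe_comp, Function.comp_apply, Submodule.subtype_apply, Finsupp.lsingle_apply] at h'
    exact Subtype.ext (Finsupp.single_injective (b j) h')
  · ext m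
    simp only [LinearMap.mem_range, Submodule.mem_comap, Submodule.subtype_apply, Submodule.mem_map]
    constructor
    · rintro ⟨e, rfl⟩
      exact ⟨(e : V), e.2, rfl⟩
    · rintro ⟨v, hv, hvm⟩
      exact ⟨⟨v, hv⟩, Subtype.ext hvm⟩
  · apply Subtype.ext
    rw [hρ₁]
    simp only [LinearMap.codRestrict_apply, LinearMap.coe_comp, Function.comp_apply, Submodule.subtype_apply, Finsupp.lsingle_apply]
    rw [rep_oneChains_single hτ₁, hg, he']

end Chains

end Representation
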